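import Summits.QuantumFields.BalabanUV.T4Continuum.Support.DirichletSubregionDefect

/-!
# T⁴ programme, spine node NE2 (U1a), sub-row Δ1 «NE2⁰-Dirichlet» — THE RENORMALISED PAIRING ON A FAMILY OF SUB-CARRIERS: the
# injection `J̃` that plants a coarse value on the sub-carrier children of its index with weight `m^{−1/2}` (`m` = their number)
# is an ISOMETRY, the averaging `Ã = L^{−d/2}J̃ᴴ` pairs with it EXACTLY (no pairing defect), and `FreeTowerLaws` hold modulo W1
# (coercivity), ONE Poincaré-form bound on the sibling classes INSIDE the carriers (PF), and the injected law (W3̃)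

Thirteenth generation of the NE2 prover lineage P1 of the cell `pub-balaban` (row NE2 owner), file 4 (owner item O13-d).  Files 1a/1b/2
of this generation (p224434/p225020/p225978) put the faithful star-bond operator on the tower with KING's pairing compressed to the star
bonds; the price was a pairing defect on the deficient (inward boundary) coarse bonds and a complement law read through the
ZERO-EXTENSION gradient, whose constant grows at least linearly in the level for the faithful operator (slab normal mode, file 3
`Support/DirichletStarSlabMode`): rate `(√L)⁻¹`.  BOTH losses come from one mismatch — King's block means average over ALL `L^d` children
of a coarse index, of which only `m < L^d` may lie in the sub-carrier.  THIS FILE removes the mismatch at the level of bookkeeping, for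
an ARBITRARY predicate family `p` and an arbitrary Hermitian operator family `D` on `pidx p k`:

 * §1 `nch k i` = the number of `p (k+1)`-children of the level-`k` index `i`; THE RENORMALISED INJECTION `JnR k (y, i) = [parT y = i]·
   (nch k i)^{−1/2}` and AVERAGING `AnR k = (√(L^d))⁻¹·(JnR k)ᴴ` (= King's `Q`/`J` on indices all of whose children are carriers);
 * §2 under `hchild` (every `p k`-index has a `p (k+1)`-child): **`JnR_conjTranspose_mul_JnR : J̃ᴴJ̃ = 1`** (isometry), `‖J̃‖ ≤ 1`,
   `‖Ã‖² ≤ L^{−d}`, and the EXACT pairing **`√(L^d)·Ã·J̃ = 1 + 0`** — NO pairing defect;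
 * §3 the complement law from W1 + ONE displayed POINCARÉ-FORM BOUND (PF) on the sibling classes INSIDE the carriers:
   `‖(1 − J̃J̃ᴴ)w‖² ≤ E·Re⟨w, D (k+1) w⟩` ⟹ **`‖(D (k+1))⁻¹(1 − J̃J̃ᴴ)‖ ≤ √(E·γ⁻¹)`** (`complement_le_renorm_of`) — `1 − J̃J̃ᴴ` is the
   projection onto fields with zero mean on every sibling class, so PF is an in-carrier Poincaré inequality times an INTERIOR
   gradient-form bound: no zero-extension, no jump across the region's boundary (the slab normal mode of file 3 is constant on classes
   and is annihilated);
 * §4 ENDs **`freeTowerLaws_renorm_of (hchild) (hherm) (hγ) (hE) (hcoer) (hPF) (hinj)`** with `F = 0`, `f = 0`, complement sequence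
   `√(E k·γ⁻¹)`; **`towerLimitRate_renorm_of`** at any geometric rate majorising `√(E k·γ⁻¹)` and the injected law;
   `towerLimitRate_renorm_perturbed_of`.

HONEST FRAMING (T4-DAG p. 1).  `U = 1` bookkeeping ([folklore]); the renormalised averaging `Ã` coincides with King's componentwise
block mean on coarse indices all of whose children are carriers and averages over the carrier children only on the others — a
MODEL of averaging near `∂Ω₀` (Bałaban's own (3.16) does not average the collar at all); ONE family of sub-carriers, ONE averaging scale
inside `D`; finite torus; linear layer; operator norm; W1, PF, W3̃ DISPLAYED; NE2 (U1a) NOT proved; spine 0/9 unchanged; NOT [B9]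
(3.23)–(3.27) as printed; NOT infinite volume, NOT a mass gap, NOT the Clay problem, NOT summit progress.  HONEST DEPENDENCY: continuum
YM on T⁴ ⇐ BetaPertH ∧ nine spine estimates (0/9 proved); BetaPertH ⇐ (D1) ∧ (D4) ∧ CAP+tail; G-an2-4 gates asym, D1 and NE2/3/4.
No `sorry`.
-/

noncomputable section

open scoped BigOperators ComplexConjugate Matrix Matrix.Norms.L2Operator

namespace Summit.QuantumFields.BalabanUV.T4Continuum.DirichletSubregionRenormTower

open Literature.MathematicalPhysics.QuantumFieldTheory.Balaban1983to89.B5Prop11Plancherel (Tor fine opNorm_le_of_sq_le)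
open Literature.MathematicalPhysics.QuantumFieldTheory.Balaban1983to89.B5Prop11Lower (nsq nsq_nonneg norm_star_dotProduct_le nsq_mulVec_le)
open Literature.MathematicalPhysics.QuantumFieldTheory.Balaban1983to89.B5G183RateUnitTower (lev)
open Summit.QuantumFields.BalabanUV.T4Continuum
open Summit.QuantumFields.BalabanUV.T4Continuum.CovariantAveragingTower (TowerLimitRate)
open Summit.QuantumFields.BalabanUV.T4Continuum.BalabanAveragedTowerUnit (idx)
open Summit.QuantumFields.BalabanUV.T4Continuum.BackgroundResolventTower
open Summit.QuantumFields.BalabanUV.T4Continuum.BackgroundResolventLaw (l2_opNorm_one_le)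
open Summit.QuantumFields.BalabanUV.T4Continuum.BlockPairingGeometry (parT)
open Summit.QuantumFields.BalabanUV.T4Continuum.SubtypeCompression
open Summit.QuantumFields.BalabanUV.T4Continuum.DirichletSubregionTowerOf (pidx)
open Summit.QuantumFields.BalabanUV.T4Continuum.PerturbationAlgebra (perturbationLaws_zero)

variable {d : ℕ} (L : ℕ) [NeZero L] (M : Fin d → ℕ) [hM : ∀ μ, NeZero (M μ)]
variable (p : (k : ℕ) → idx L M k → Prop) [hp : ∀ k, DecidablePred (p k)]

/-! ## §1 The number of carrier children; the renormalised injection and averaging -/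

/-- the number of `p (k+1)`-children of the level-`k` index `i`. [folklore] -/
def nch (k : ℕ) (i : idx L M k) : ℕ :=
  (Finset.univ.filter fun y : pidx L M p (k + 1) => parT (lev L k) L M y.1 = i).card

/-- **THE RENORMALISED INJECTION** `J̃_{y i} = [parT y = i]·(nch i)^{−1/2}`: plants the coarse value on the carrier children, with the
weight that makes it an isometry. [folklore] -/
def JnR (k : ℕ) : Matrix (pidx L M p (k + 1)) (pidx L M p k) ℂ :=
  fun y i => if parT (lev L k) L M y.1 = i.1 then (((Real.sqrt (nch L M p k i.1))⁻¹ : ℝ) : ℂ) else 0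

/-- **THE RENORMALISED AVERAGING** `Ã = (√(L^d))⁻¹·J̃ᴴ`: the mean over the CARRIER children (King's block mean where all children are
carriers), in the tower's normalisation `‖Ã‖² ≤ L^{−d}`. [folklore] -/
def AnR (k : ℕ) : Matrix (pidx L M p k) (pidx L M p (k + 1)) ℂ :=
  ((((Real.sqrt ((L : ℝ) ^ d))⁻¹ : ℝ) : ℂ)) • (JnR L M p k)ᴴ

/-! ## §2 Isometry, norms, exact pairing -/

/-- **`J̃ᴴJ̃ = 1`** when every `p k`-index has a carrier child. [folklore] -/
theorem JnR_conjTranspose_mul_JnR (hchild : ∀ (k : ℕ) (i : pidx L M p k), 0 < nch L M p k i.1) (k : ℕ) :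
    (JnR L M p k)ᴴ * JnR L M p k = 1 := by
  ext i i'
  rw [Matrix.mul_apply, Matrix.one_apply]
  by_cases hii : i = i'
  · subst hii
    rw [if_pos rfl]
    have hm : (0 : ℝ) < nch L M p k i.1 := by exact_mod_cast hchild k i
    have e : ∀ y : pidx L M p (k + 1), (JnR L M p k)ᴴ i y * JnR L M p k y i
        = if parT (lev L k) L M y.1 = i.1 then (((nch L M p k i.1 : ℝ)⁻¹ : ℝ) : ℂ) else 0 := by
      intro y
      rw [Matrix.conjTranspose_apply]
      unfold JnR
      split_ifs with h
      · rw [Complex.star_def, Complex.conj_ofReal, ← Complex.ofReal_mul, ← sq, inv_pow, Real.sq_sqrt hm.le]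
      · rw [star_zero, zero_mul]
    rw [Finset.sum_congr rfl (fun y _ => e y), Finset.sum_ite, Finset.sum_const_zero, add_zero, Finset.sum_const]
    rw [show (Finset.univ.filter fun y : pidx L M p (k + 1) => parT (lev L k) L M y.1 = i.1).card = nch L M p k i.1 from rfl]
    rw [nsmul_eq_mul, ← Complex.ofReal_natCast, ← Complex.ofReal_mul, mul_inv_cancel₀ hm.ne', Complex.ofReal_one]
  · rw [if_neg hii]
    refine Finset.sum_eq_zero fun y _ => ?_
    rw [Matrix.conjTranspose_apply]
    unfold JnR
    by_cases h1 : parT (lev L k) L M y.1 = i.1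
    · have h2 : ¬ parT (lev L k) L M y.1 = i'.1 := fun h => hii (Subtype.ext (h1.symm.trans h))
      rw [if_neg h2, mul_zero]
    · rw [if_neg h1, star_zero, zero_mul]

/-- hence `‖J̃‖ ≤ 1`. [folklore] -/
theorem opNorm_JnR_le (hchild : ∀ (k : ℕ) (i : pidx L M p k), 0 < nch L M p k i.1) (k : ℕ) : ‖JnR L M p k‖ ≤ 1 := by
  have h : ‖JnR L M p k‖ * ‖JnR L M p k‖ ≤ 1 := by
    rw [← Matrix.l2_opNorm_conjTranspose_mul_self, JnR_conjTranspose_mul_JnR L M p hchild k]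
    exact l2_opNorm_one_le
  nlinarith [norm_nonneg (JnR L M p k)]

/-- `‖Ã‖² ≤ L^{−d}`. [folklore] -/
theorem opNorm_AnR_sq_le (hchild : ∀ (k : ℕ) (i : pidx L M p k), 0 < nch L M p k i.1) (k : ℕ) :
    ‖AnR L M p k‖ ^ 2 ≤ ((L : ℝ) ^ d)⁻¹ := by
  have hr : (0 : ℝ) < (L : ℝ) ^ d := pow_pos (by exact_mod_cast Nat.pos_of_ne_zero (NeZero.ne L)) d
  unfold AnR
  rw [norm_smul, Complex.norm_real, Real.norm_of_nonneg (inv_nonneg.mpr (Real.sqrt_nonneg _)), Matrix.l2_opNorm_conjTranspose,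
    mul_pow, inv_pow, Real.sq_sqrt hr.le]
  calc ((L : ℝ) ^ d)⁻¹ * ‖JnR L M p k‖ ^ 2 ≤ ((L : ℝ) ^ d)⁻¹ * 1 :=
        mul_le_mul_of_nonneg_left (pow_le_one₀ (norm_nonneg _) (opNorm_JnR_le L M p hchild k)) (inv_nonneg.mpr hr.le)
    _ = ((L : ℝ) ^ d)⁻¹ := mul_one _

/-- **THE EXACT PAIRING, NO DEFECT**: `√(L^d)·Ã·J̃ = 1 + 0`. [folklore] -/
theorem sqrt_smul_AnR_mul_JnR (hchild : ∀ (k : ℕ) (i : pidx L M p k), 0 < nch L M p k i.1) (k : ℕ) :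
    ((((Real.sqrt ((L : ℝ) ^ d)) : ℝ) : ℂ)) • (AnR L M p k * JnR L M p k) = 1 + 0 := by
  have hr : (0 : ℝ) < (L : ℝ) ^ d := pow_pos (by exact_mod_cast Nat.pos_of_ne_zero (NeZero.ne L)) d
  have hs : (((Real.sqrt ((L : ℝ) ^ d)) : ℝ) : ℂ) ≠ 0 := by exact_mod_cast (Real.sqrt_pos.mpr hr).ne'
  rw [add_zero, AnR, Matrix.smul_mul, smul_smul, JnR_conjTranspose_mul_JnR L M p hchild k, ← Complex.ofReal_mul,
    mul_inv_cancel₀ (Real.sqrt_pos.mpr hr).ne', Complex.ofReal_one, one_smul]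

/-! ## §3 The complement law from W1 + the Poincaré-form bound on the sibling classes -/

section Complement

variable (D : (k : ℕ) → Matrix (pidx L M p k) (pidx L M p k) ℂ) (k : ℕ)

/-- `Π̃ = J̃J̃ᴴ` is Hermitian, hence so is `1 − Π̃`. [folklore] -/
theorem one_sub_proj_conjTranspose : (1 - JnR L M p k * (JnR L M p k)ᴴ)ᴴ = 1 - JnR L M p k * (JnR L M p k)ᴴ := by
  rw [Matrix.conjTranspose_sub, Matrix.conjTranspose_one, Matrix.conjTranspose_mul, Matrix.conjTranspose_conjTranspose]

/-- **THE COMPLEMENT LAW FROM W1 + PF**: coercivity `γ` of `D (k+1)` and the Poincaré-form bound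
`‖(1 − J̃J̃ᴴ)w‖² ≤ E·Re⟨w, D (k+1) w⟩` give `‖(D (k+1))⁻¹(1 − J̃J̃ᴴ)‖ ≤ √(E·γ⁻¹)`. [folklore] -/
theorem complement_le_renorm_of (hherm : (D (k + 1)).IsHermitian) {γ E : ℝ} (hγ : 0 < γ) (hE : 0 ≤ E)
    (hcoer : Coercive (D (k + 1)) γ)
    (hPF : ∀ w : pidx L M p (k + 1) → ℂ,
      nsq ((1 - JnR L M p k * (JnR L M p k)ᴴ) *ᵥ w) ≤ E * (star w ⬝ᵥ (D (k + 1) *ᵥ w)).re) :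
    ‖(D (k + 1))⁻¹ * (1 - JnR L M p k * (JnR L M p k)ᴴ)‖ ≤ Real.sqrt (E * γ⁻¹) := by
  set Dk := D (k + 1) with hDk
  set Y := 1 - JnR L M p k * (JnR L M p k)ᴴ with hY
  have hU : IsUnit Dk.det := isUnit_det_of_coercive hγ hcoer
  have hG : ‖Dk⁻¹‖ ≤ γ⁻¹ := opNorm_inv_le_of_coercive hγ hcoer
  have hYh : Yᴴ = Y := one_sub_proj_conjTranspose L M p k
  have e1 : ‖Dk⁻¹ * Y‖ = ‖Y * Dk⁻¹‖ := by
    rw [← Matrix.l2_opNorm_conjTranspose (Dk⁻¹ * Y), Matrix.conjTranspose_mul, hherm.inv.eq, hYh]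
  rw [e1]
  refine opNorm_le_of_sq_le _ (Real.sqrt_nonneg _) fun y => ?_
  set v := Dk⁻¹ *ᵥ y with hv
  have e2 : ∑ i, ‖∑ j, (Y * Dk⁻¹) i j * y j‖ ^ 2 = nsq (Y *ᵥ v) := by rw [hv, Matrix.mulVec_mulVec]; rfl
  have e3 : ∑ j, ‖y j‖ ^ 2 = nsq y := rfl
  rw [e2, e3, Real.sq_sqrt (mul_nonneg hE (inv_nonneg.mpr hγ.le))]
  have hDv : Dk *ᵥ v = y := by rw [hv, Matrix.mulVec_mulVec, Matrix.mul_nonsing_inv _ hU, Matrix.one_mulVec]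
  have hform : (star v ⬝ᵥ (Dk *ᵥ v)).re ≤ γ⁻¹ * nsq y := by
    rw [hDv]
    have h3 : (star v ⬝ᵥ y).re ≤ Real.sqrt (nsq v) * Real.sqrt (nsq y) :=
      (Complex.re_le_norm _).trans (norm_star_dotProduct_le v y)
    have h4 : nsq v ≤ γ⁻¹ ^ 2 * nsq y :=
      (nsq_mulVec_le Dk⁻¹ y).trans (mul_le_mul_of_nonneg_right (pow_le_pow_left₀ (norm_nonneg _) hG 2) (nsq_nonneg _))
    have h5 : Real.sqrt (nsq v) ≤ γ⁻¹ * Real.sqrt (nsq y) := by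
      rw [← Real.sqrt_sq (inv_nonneg.mpr hγ.le), ← Real.sqrt_mul (sq_nonneg _)]
      exact Real.sqrt_le_sqrt h4
    have hsy : Real.sqrt (nsq y) * Real.sqrt (nsq y) = nsq y := Real.mul_self_sqrt (nsq_nonneg _)
    calc (star v ⬝ᵥ y).re ≤ Real.sqrt (nsq v) * Real.sqrt (nsq y) := h3
      _ ≤ γ⁻¹ * Real.sqrt (nsq y) * Real.sqrt (nsq y) := mul_le_mul_of_nonneg_right h5 (Real.sqrt_nonneg _)
      _ = γ⁻¹ * nsq y := by rw [mul_assoc, hsy]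
  calc nsq (Y *ᵥ v) ≤ E * (star v ⬝ᵥ (Dk *ᵥ v)).re := hPF v
    _ ≤ E * (γ⁻¹ * nsq y) := mul_le_mul_of_nonneg_left hform hE
    _ = E * γ⁻¹ * nsq y := by ring

end Complement

/-! ## §4 The ENDs: free tower laws with NO pairing defect, modulo W1, PF, W3̃ -/

section End

variable (D : (k : ℕ) → Matrix (pidx L M p k) (pidx L M p k) ℂ)

/-- **THE FREE TOWER LAWS FOR THE RENORMALISED PAIRING ON ANY SUB-CARRIER FAMILY, MODULO W1 + PF + W3̃** — no pairing defect
(`F = 0`, `f = 0`), complement sequence `√(E k·γ⁻¹)`. [folklore] -/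
theorem freeTowerLaws_renorm_of (hchild : ∀ (k : ℕ) (i : pidx L M p k), 0 < nch L M p k i.1)
    (hherm : ∀ k, (D k).IsHermitian) {γ : ℝ} {E : ℕ → ℝ} (hγ : 0 < γ) (hE : ∀ k, 0 ≤ E k) (hcoer : ∀ k, Coercive (D k) γ)
    (hPF : ∀ (k : ℕ) (w : pidx L M p (k + 1) → ℂ),
      nsq ((1 - JnR L M p k * (JnR L M p k)ᴴ) *ᵥ w) ≤ E k * (star w ⬝ᵥ (D (k + 1) *ᵥ w)).re)
    {e₁ : ℕ → ℝ} (hinj : ∀ k, ‖(D (k + 1))⁻¹ * JnR L M p k - JnR L M p k * (D k)⁻¹‖ ≤ e₁ k) :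
    FreeTowerLaws D (AnR L M p) (JnR L M p) (fun _ => 0) ((L : ℝ) ^ d) (fun k => Real.sqrt (E k * γ⁻¹)) e₁ (fun _ => 0) where
  isUnit_det := fun k => isUnit_det_of_coercive hγ (hcoer k)
  opNorm_A_sq_le := opNorm_AnR_sq_le L M p hchild
  opNorm_J_le := opNorm_JnR_le L M p hchild
  A_mul_J := sqrt_smul_AnR_mul_JnR L M p hchild
  opNorm_F_mul_inv_le := fun k => by rw [Matrix.zero_mul, norm_zero]
  opNorm_inv_mul_F_le := fun k => by rw [Matrix.conjTranspose_zero, Matrix.mul_zero, norm_zero]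
  complement_le := fun k => complement_le_renorm_of L M p D k (hherm (k + 1)) hγ (hE k) (hcoer (k + 1)) (hPF k)
  injected_le := hinj

/-- **CONVERGENCE MODULO W1 + PF + W3̃ AT ANY GEOMETRIC RATE `θ < 1`** majorising `√(E k·γ⁻¹)` and the injected law. [folklore] -/
theorem towerLimitRate_renorm_of (hchild : ∀ (k : ℕ) (i : pidx L M p k), 0 < nch L M p k i.1)
    (hherm : ∀ k, (D k).IsHermitian) {γ : ℝ} {E : ℕ → ℝ} (hγ : 0 < γ) (hE : ∀ k, 0 ≤ E k) (hcoer : ∀ k, Coercive (D k) γ)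
    (hPF : ∀ (k : ℕ) (w : pidx L M p (k + 1) → ℂ),
      nsq ((1 - JnR L M p k * (JnR L M p k)ᴴ) *ᵥ w) ≤ E k * (star w ⬝ᵥ (D (k + 1) *ᵥ w)).re)
    {θ C₀ C₁ : ℝ} (hθ1 : θ < 1) (h₀ : ∀ k, Real.sqrt (E k * γ⁻¹) ≤ C₀ * θ ^ k)
    (hinj : ∀ k, ‖(D (k + 1))⁻¹ * JnR L M p k - JnR L M p k * (D k)⁻¹‖ ≤ C₁ * θ ^ k) :
    TowerLimitRate (AnR L M p) ((L : ℝ) ^ d) (fun k => (D k)⁻¹) (Cpert 0 C₀ C₁ 0 0 0) θ := by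
  have hr : (0 : ℝ) < (L : ℝ) ^ d := pow_pos (by exact_mod_cast Nat.pos_of_ne_zero (NeZero.ne L)) d
  have ht : ‖(0 : ℂ)‖ * 0 < 1 := by rw [norm_zero, zero_mul]; exact one_pos
  have h := towerLimitRate_perturbed hr (freeTowerLaws_renorm_of L M p D hchild hherm hγ hE hcoer hPF hinj)
    (perturbationLaws_zero (D := D) (J := JnR L M p)) hθ1 h₀ (fun k => le_rfl) (fun k => by rw [zero_mul])
    (fun k => by rw [zero_mul]) ht
  simp only [zero_smul, add_zero] at h
  exact h

/-- **THE RESOLVENT ROUTE FOR THE RENORMALISED PAIRING** (modulo W1 + PF + W3̃): any compressed perturbation family with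
`PerturbationLaws D P J̃ κ (k ↦ C₂θ^k)`, any `‖t‖κ < 1`. [folklore] -/
theorem towerLimitRate_renorm_perturbed_of (hchild : ∀ (k : ℕ) (i : pidx L M p k), 0 < nch L M p k i.1)
    (hherm : ∀ k, (D k).IsHermitian) {γ : ℝ} {E : ℕ → ℝ} (hγ : 0 < γ) (hE : ∀ k, 0 ≤ E k) (hcoer : ∀ k, Coercive (D k) γ)
    (hPF : ∀ (k : ℕ) (w : pidx L M p (k + 1) → ℂ),
      nsq ((1 - JnR L M p k * (JnR L M p k)ᴴ) *ᵥ w) ≤ E k * (star w ⬝ᵥ (D (k + 1) *ᵥ w)).re)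
    {θ C₀ C₁ : ℝ} (hθ1 : θ < 1) (h₀ : ∀ k, Real.sqrt (E k * γ⁻¹) ≤ C₀ * θ ^ k)
    (hinj : ∀ k, ‖(D (k + 1))⁻¹ * JnR L M p k - JnR L M p k * (D k)⁻¹‖ ≤ C₁ * θ ^ k)
    {P : (k : ℕ) → Matrix (pidx L M p k) (pidx L M p k) ℂ} {κ C₂ : ℝ}
    (hpert : PerturbationLaws D P (JnR L M p) κ (fun k => C₂ * θ ^ k)) {t : ℂ} (ht : ‖t‖ * κ < 1) :
    TowerLimitRate (AnR L M p) ((L : ℝ) ^ d) (fun k => (D k + t • P k)⁻¹) (Cpert κ C₀ C₁ C₂ 0 t) θ := by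
  have hr : (0 : ℝ) < (L : ℝ) ^ d := pow_pos (by exact_mod_cast Nat.pos_of_ne_zero (NeZero.ne L)) d
  exact towerLimitRate_perturbed hr (freeTowerLaws_renorm_of L M p D hchild hherm hγ hE hcoer hPF hinj) hpert hθ1 h₀
    (fun k => le_rfl) (fun k => le_rfl) (fun k => by rw [zero_mul]) ht

end End

end Summit.QuantumFields.BalabanUV.T4Continuum.DirichletSubregionRenormTower

end
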